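import Summits.KontsevichZagierPeriods.KontsevichZagierPeriods.Theorems.RootDecompWalshStrataBall4Rung
import Summits.KontsevichZagierPeriods.KontsevichZagierPeriods.Theorems.RootDecompWalshStrataCone4Descent

/-!
# `QuadricFour` rung: the cone cell `x₃² > x₀² + x₁² + x₂²` is a fourth instance of `QuadricTwoDescentFour`

Route `RootDecompWalshStrata` (cell decomp-kz, lens 4, gen 11).  Plugs the proved cone descent
(`Cone4.cone4_twoDescent`, parts `RootDecompWalshStrataCone4{Band,Chart,Descent}`) into the typed node of
`RootDecompWalshStrataQuadricFourRung` / `…Ball4Rung`: `quadricTwoDescentFourAt_cone4 :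
QuadricTwoDescentFourAt cone4Poly` — after the 4-ball `(4,0)`, the paraboloid (rank 3 + linear) and the
split type `(2,2)`, the LORENTZIAN type `(3,1)` (value `q·π/24`) is decided inside the rules, the
square root of the first descent removed by the polynomial Pythagorean chart.  0 sorry.
[KontsevichZagier2001 §1.2]
-/

namespace Summit.KontsevichZagierPeriods.RootDecompWalshStrata.QuadricFourRung

open Literature.NumberTheory.Transcendental
open Summit.KontsevichZagierPeriods.RootDecompWalshStrata.Cone4 (cone4Poly cone4_twoDescent)

/-- `deg (x₃² − x₀² − x₁² − x₂²) ≤ 2`. [folklore] -/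
theorem totalDegree_cone4Poly_le : cone4Poly.totalDegree ≤ 2 := by
  unfold cone4Poly
  refine (MvPolynomial.totalDegree_sub _ _).trans (max_le ?_ ?_)
  · refine (MvPolynomial.totalDegree_sub _ _).trans (max_le ?_ ?_)
    · refine (MvPolynomial.totalDegree_sub _ _).trans (max_le ?_ ?_)
      · simp [MvPolynomial.totalDegree_X_pow]
      · simp [MvPolynomial.totalDegree_X_pow]
    · simp [MvPolynomial.totalDegree_X_pow]
  · simp [MvPolynomial.totalDegree_X_pow]

/-- **Fourth specimen of generation 11:** the slice of `QuadricTwoDescentFour` at the cone cell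
`x₃² > x₀² + x₁² + x₂²` holds — decided inside the three KZ rules (`Cone4.cone4_twoDescent`).
[KontsevichZagier2001 §1.2; this node] -/
theorem quadricTwoDescentFourAt_cone4 : QuadricTwoDescentFourAt cone4Poly :=
  fun q ρ hρ _ => cone4_twoDescent q ρ hρ

end Summit.KontsevichZagierPeriods.RootDecompWalshStrata.QuadricFourRung
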